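import Summits.AnomalousDissipation.AnomalousDissipation.Theorems.SolenoidalFractalHomogenisationLagrangianStepVmodFfCoarseDispatch
import Summits.AnomalousDissipation.AnomalousDissipation.Theorems.SolenoidalFractalHomogenisationLagrangianStepVmodFfHigh
import Summits.AnomalousDissipation.AnomalousDissipation.Theorems.SolenoidalFractalHomogenisationLagrangianStepVmodFfTextsP
import Summits.AnomalousDissipation.AnomalousDissipation.Theorems.SolenoidalFractalHomogenisationLagrangianStepVmodSfModeGrid
import HarnessLib

/-!
# K1L_D (stmt-AnomalousDissipation-27980): (V_mod) flat stage — THE (ff) PER-LABEL TEXT AT GRID PHASE: `ffModeP_grid : FFModeP_textEVH e`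
# for every exponent map with `0 < e σ ≤ 1/2` (prover ad-k3l-bookkeeping-p1 g10; RULING D28-9 / D28-17 (a) assign the (ff) grid twin to k3l;
# `--kind proof --supports 27980 --as helper`)

The (ff) twin of `…VmodSfModeGrid.sfModeP_grid` (p725568), SAME recipe: the smallness scale / ν-floor `t₀ = (1/(50(2√2C²+1)))^{1/σ}`, the
coarse/high threshold `g₀` = p1's minimum of six smallness conditions (so that `VmodGen.coarse_smallness`, p717612, applies VERBATIM), the high-label
family at `Kb = (K+1)/g₀` (inside `ffMode_high`), and the block constant `C₂ := C₂ʰ + C₁ᶜ`,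
`C₁ᶜ := 8750·cSp + 4240/a₁² + √2·cSp + 1/√a₁ + F/t₀^{eσ} + 1` (`cSp = 8Σ‖slotAmp W‖/(π(lo/Λ)√(8π²(lo/Λ)M·Wp·c))`, `a₁ = π²(lo/Λ)M·Wp/2`,
`F = 4Σ‖slotAmp W‖/(π(lo/Λ)t₀)`), `C₂ʰ` from `ffMode_high`.  Dispatch per label: COARSE `‖ℓ‖⌈K/ν⌉ ≤ g₀n` →
`VmodGen.pairing_le_alw_dispatch_coarse_fast` (mid / ν-floor / long fast rows); HIGH → `ffMode_high` (W7 on class data, any phase); monotonicity of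
the allowance in the constant (`alw_mono`).  `sorry`-free; NOT a proof of (ff) (the reduction `bffP_of_ffModeP` is the companion file), of
`stub_Vmod_EHTthg`, of K1L_D or of AD; rung F-D1.A0.
-/

set_option linter.dupNamespace false

noncomputable section

namespace Summit.AnomalousDissipation.AnomalousDissipation.Theorems.SolenoidalFractalHomogenisation.LagrangianStep.VmodFlat

open Literature.Analysis Literature.Analysis.FluidPDE Literature.Analysis.FunctionSpaces
open MeasureTheory Set Filter UnitAddTorus
open scoped ENNReal NNReal InnerProductSpace
open Summit.AnomalousDissipation.AnomalousDissipation.Theorems.SolenoidalFractalHomogenisation.LagrangianStep.CellClauseMod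
open Summit.AnomalousDissipation.AnomalousDissipation.Theorems.SolenoidalFractalHomogenisation.LagrangianStep.Sideband (slotAmp)

set_option maxHeartbeats 3200000 in
/-- **THE (ff) PER-LABEL TEXT AT GRID STARTS**, for every exponent map with `0 < e σ ≤ 1/2`.  See the module docstring. -/
theorem ffModeP_grid (e : ℝ → ℝ) (he : ∀ σ, 0 < σ → 0 < e σ ∧ e σ ≤ 1 / 2) : FFModeP_textEVH e := by
  intro k W M hM c hc Φ lo hi Λ β σ C ν₀ K hlo _hlo1 hhi hΛ _hβ hσ hC _hν₀ hν₀1 hK hV hHfam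
  obtain ⟨he0, he12⟩ := he σ hσ
  -- ### scalars of the clause
  have hΛ0 : 0 < Λ := by linarith only [hΛ]
  have hloΛ : 0 < lo / Λ := div_pos hlo hΛ0
  have hWp := Summit.AnomalousDissipation.AnomalousDissipation.Theorems.SolenoidalFractalHomogenisation.PermissibleCarrier.period_pos W
  have hMW : 0 < M * W.period := mul_pos hM hWp
  have hX0 : 0 ≤ 2 * Real.sqrt 2 * C ^ 2 := by positivity
  -- ### the smallness scale `t₀` (also the `ν`-floor) — p1's recipe
  obtain ⟨a₀, ha₀⟩ : ∃ a₀ : ℝ, a₀ = 1 / (50 * (2 * Real.sqrt 2 * C ^ 2 + 1)) := ⟨_, rfl⟩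
  have ha₀0 : 0 < a₀ := by rw [ha₀]; positivity
  have ha₀1 : a₀ ≤ 1 := by rw [ha₀, div_le_one (by positivity)]; linarith only [hX0]
  obtain ⟨t₀, ht₀⟩ : ∃ t₀ : ℝ, t₀ = a₀ ^ (1 / σ) := ⟨_, rfl⟩
  have ht₀0 : 0 < t₀ := by rw [ht₀]; exact Real.rpow_pos_of_pos ha₀0 _
  have ht₀σ : t₀ ^ σ = a₀ := by rw [ht₀, ← Real.rpow_mul ha₀0.le, one_div_mul_cancel hσ.ne', Real.rpow_one]
  have hsmallσ : ∀ x : ℝ, 0 ≤ x → x ≤ t₀ → 2 * Real.sqrt 2 * C ^ 2 * x ^ σ ≤ 1 / 50 := by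
    intro x hx hxt
    have h1 : x ^ σ ≤ a₀ := (Real.rpow_le_rpow hx hxt hσ.le).trans ht₀σ.le
    have h2 := mul_le_mul_of_nonneg_left h1 hX0
    refine h2.trans ?_
    rw [ha₀, mul_one_div, div_le_div_iff₀ (by positivity) (by norm_num)]
    linarith only [hX0]
  -- ### the coarse/high threshold `g₀` — p1's recipe
  have hA0 : 0 < (8 * Real.pi ^ 2 * (lo / Λ) * (M * W.period) * (1 + c) / K ^ 2) := by positivity
  have hB0 : 0 ≤ (12 * k * Real.exp (9 * (k : ℝ) ^ 2 / (2 * Real.pi ^ 4 * (lo / Λ) ^ 2 * c)) / (Real.pi ^ 2 * (lo / Λ) * K)) := by positivity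
  have hBs0 : 0 ≤ (24 * (∑ j, ‖slotAmp W j‖) / (Real.pi * (lo / Λ) * K)) := by positivity
  obtain ⟨g₀, hg₀⟩ : ∃ g₀ : ℝ, g₀ = min 1 (min t₀ (min ((1 / (50 * (2 * Real.sqrt 2 * C * (hi * Λ ^ 2 / lo) + 1))) / (8 * Real.pi ^ 2 * (lo / Λ) * (M * W.period) * (1 + c) / K ^ 2))
      (min (1 / (50 * ((12 * k * Real.exp (9 * (k : ℝ) ^ 2 / (2 * Real.pi ^ 4 * (lo / Λ) ^ 2 * c)) / (Real.pi ^ 2 * (lo / Λ) * K)) + 1))) (min (1 / (50 * ((24 * (∑ j, ‖slotAmp W j‖) / (Real.pi * (lo / Λ) * K)) + 1))) (K ^ 2 / (800 * (1 + c))))))) := ⟨_, rfl⟩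
  have hg₀0 : 0 < g₀ := by rw [hg₀]; positivity
  have hg₀1 : g₀ ≤ 1 := by rw [hg₀]; exact min_le_left _ _
  have hg₀t : g₀ ≤ t₀ := by rw [hg₀]; exact (min_le_right _ _).trans (min_le_left _ _)
  have hg₀A : g₀ ≤ (1 / (50 * (2 * Real.sqrt 2 * C * (hi * Λ ^ 2 / lo) + 1))) / (8 * Real.pi ^ 2 * (lo / Λ) * (M * W.period) * (1 + c) / K ^ 2) := by
    rw [hg₀]; exact (min_le_right _ _).trans ((min_le_right _ _).trans (min_le_left _ _))
  have hg₀B : g₀ ≤ 1 / (50 * ((12 * k * Real.exp (9 * (k : ℝ) ^ 2 / (2 * Real.pi ^ 4 * (lo / Λ) ^ 2 * c)) / (Real.pi ^ 2 * (lo / Λ) * K)) + 1)) := by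
    rw [hg₀]; exact (min_le_right _ _).trans ((min_le_right _ _).trans ((min_le_right _ _).trans (min_le_left _ _)))
  have hg₀Bs : g₀ ≤ 1 / (50 * ((24 * (∑ j, ‖slotAmp W j‖) / (Real.pi * (lo / Λ) * K)) + 1)) := by
    rw [hg₀]
    exact (min_le_right _ _).trans ((min_le_right _ _).trans ((min_le_right _ _).trans ((min_le_right _ _).trans (min_le_left _ _))))
  have hg₀d : g₀ ≤ K ^ 2 / (800 * (1 + c)) := by
    rw [hg₀]
    exact (min_le_right _ _).trans ((min_le_right _ _).trans ((min_le_right _ _).trans ((min_le_right _ _).trans (min_le_right _ _))))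
  have hgσ : 2 * Real.sqrt 2 * C ^ 2 * g₀ ^ σ ≤ 1 / 50 := hsmallσ g₀ hg₀0.le hg₀t
  have hνcσ : 2 * Real.sqrt 2 * C ^ 2 * t₀ ^ σ ≤ 1 / 50 := hsmallσ t₀ ht₀0.le le_rfl
  have hAg : (8 * Real.pi ^ 2 * (lo / Λ) * (M * W.period) * (1 + c) / K ^ 2) * g₀ ≤ (1 / (50 * (2 * Real.sqrt 2 * C * (hi * Λ ^ 2 / lo) + 1))) := by
    rw [mul_comm]; exact (le_div_iff₀ hA0).1 hg₀A
  have hBg : (12 * k * Real.exp (9 * (k : ℝ) ^ 2 / (2 * Real.pi ^ 4 * (lo / Λ) ^ 2 * c)) / (Real.pi ^ 2 * (lo / Λ) * K)) * g₀ ≤ 1 / 50 := by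
    refine (mul_le_mul_of_nonneg_left hg₀B hB0).trans ?_
    rw [mul_one_div, div_le_div_iff₀ (by positivity) (by norm_num)]; linarith only [hB0]
  have hBsg : (24 * (∑ j, ‖slotAmp W j‖) / (Real.pi * (lo / Λ) * K)) * g₀ ≤ 1 / 50 := by
    refine (mul_le_mul_of_nonneg_left hg₀Bs hBs0).trans ?_
    rw [mul_one_div, div_le_div_iff₀ (by positivity) (by norm_num)]; linarith only [hBs0]
  have hgd : 16 * (1 + c) * g₀ / K ^ 2 ≤ 1 / 50 := by
    rw [div_le_div_iff₀ (by positivity) (by norm_num)]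
    have := (le_div_iff₀ (by positivity : (0:ℝ) < 800 * (1 + c))).1 hg₀d
    linarith only [this]
  -- ### the high rows at this `g₀` (W7 at `Kb = (K+1)/g₀`, any phase)
  obtain ⟨C₂h, hC₂h0, hhigh⟩ := ffMode_high e he hg₀0 hg₀1 W M hM hlo hhi hΛ hσ hν₀1 hK hHfam
  -- ### the coarse constant
  set cSp : ℝ := 8 * (∑ j, ‖slotAmp W j‖) / (Real.pi * (lo / Λ) * Real.sqrt (8 * Real.pi ^ 2 * (lo / Λ) * (M * W.period) * c)) with hcSp
  have hcSp0 : 0 ≤ cSp := by rw [hcSp]; positivity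
  have hte0 : 0 < t₀ ^ e σ := Real.rpow_pos_of_pos ht₀0 _
  set a₁ : ℝ := Real.pi ^ 2 * (lo / Λ) * (M * W.period) / 2 with ha₁
  have ha₁0 : 0 < a₁ := by rw [ha₁]; positivity
  set ia : ℝ := 1 / Real.sqrt a₁ with hia
  have hia0 : 0 ≤ ia := by rw [hia]; positivity
  set Ba : ℝ := 4240 / a₁ ^ 2 with hBa
  have hBa0 : 0 ≤ Ba := by rw [hBa]; positivity
  set F : ℝ := 4 * (∑ j, ‖slotAmp W j‖) / (Real.pi * (lo / Λ) * t₀) with hF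
  have hF0 : 0 ≤ F := by rw [hF]; positivity
  set C₁c : ℝ := 8750 * cSp + Ba + Real.sqrt 2 * cSp + ia + F / t₀ ^ e σ + 1 with hC₁c
  have hFt0 : 0 ≤ F / t₀ ^ e σ := by positivity
  have hs2cSp : 0 ≤ Real.sqrt 2 * cSp := by positivity
  have hC₁c1 : 1 ≤ C₁c := by rw [hC₁c]; linarith [hcSp0, hBa0, hia0, hFt0, hs2cSp]
  have hC₁c0 : 0 ≤ C₁c := by linarith
  have hC₁m : Real.sqrt 2 * cSp + ia ≤ C₁c := by rw [hC₁c]; linarith [hcSp0, hBa0, hFt0]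
  have hC₁k : ia ≤ C₁c := by rw [hC₁c]; linarith [hcSp0, hBa0, hFt0, hs2cSp]
  have hC₁s : 8750 * cSp + Ba ≤ C₁c := by rw [hC₁c]; linarith [hia0, hFt0, hs2cSp]
  have hC₁f : F ≤ C₁c * C₁c * t₀ ^ e σ := by
    have h1 : F / t₀ ^ e σ ≤ C₁c := by rw [hC₁c]; linarith [hcSp0, hBa0, hia0, hs2cSp]
    have h2 : F ≤ C₁c * t₀ ^ e σ := by
      have := (div_le_iff₀ hte0).1 h1; linarith
    calc F ≤ C₁c * t₀ ^ e σ := h2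
      _ = 1 * C₁c * t₀ ^ e σ := by ring
      _ ≤ C₁c * C₁c * t₀ ^ e σ := by
          have : 0 ≤ C₁c * t₀ ^ e σ := by positivity
          nlinarith
  -- ### the block constant
  refine ⟨C₂h + C₁c, by positivity, ?_⟩
  intro ν hν n hn 𝔸 hodd hwin hΦo hΦw Tw hTw U T hU hT j t s hst htT hlong ℓ hℓ w hw hwcl hw1 hw2 ζ hζ
  have hs0 : 0 ≤ s := by
    show (0:ℝ) ≤ (j : ℝ) * (M * W.period / ν)
    exact mul_nonneg (Nat.cast_nonneg j) (div_nonneg hMW.le hν.1.le)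
  have hτ0 : 0 < t - s := by linarith
  -- the allowance pieces are nonnegative
  have hXe0 : 0 ≤ ν ^ e σ + ((⌈K / ν⌉₊ : ℝ) / n) ^ e σ := by
    have h1 : 0 ≤ ν ^ e σ := Real.rpow_nonneg hν.1.le _
    have h2 : 0 ≤ ((⌈K / ν⌉₊ : ℝ) / n) ^ e σ := Real.rpow_nonneg (by positivity) _
    linarith
  have hm0 : 0 ≤ (min 1 ((M * W.period / ν) / (t - s))) ^ e σ :=
    Real.rpow_nonneg (le_min zero_le_one (div_nonneg (div_nonneg hMW.le hν.1.le) hτ0.le)) _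
  have hrest : 0 ≤ ‖w‖ * ‖ζ‖ := by positivity
  by_cases hco : ‖Torus.latticeVec ℓ‖ * (⌈K / ν⌉₊ : ℝ) ≤ g₀ * n
  · -- COARSE label: the dispatch with the constant `C₁c ≤ C₂h + C₁c`
    have h := VmodGen.pairing_le_alw_dispatch_coarse_fast hV hlo hhi hΛ hσ hC hν₀1 hK hc he0 he12 hg₀0 hg₀1 hgσ ht₀0 hνcσ hAg hBg hBsg
      hgd hC₁c0 hC₁m hC₁f hC₁k hC₁s hν hn hodd hwin hΦw hU hT hst htT j (show s = (j : ℝ) * (M * W.period / ν) from rfl) hlong hℓ hco w hw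
      hwcl hw1 hw2 ζ hζ
    refine h.trans ?_
    have hmono := alw_mono hC₁c0 (show C₁c ≤ C₂h + C₁c by linarith) hXe0 hm0
    calc (C₁c * (C₁c * (ν ^ e σ + ((⌈K / ν⌉₊ : ℝ) / n) ^ e σ) + (min 1 ((M * W.period / ν) / (t - s))) ^ e σ)) * ‖w‖ * ‖ζ‖
        = (C₁c * (C₁c * (ν ^ e σ + ((⌈K / ν⌉₊ : ℝ) / n) ^ e σ) + (min 1 ((M * W.period / ν) / (t - s))) ^ e σ)) * (‖w‖ * ‖ζ‖) := by ring
      _ ≤ ((C₂h + C₁c) * ((C₂h + C₁c) * (ν ^ e σ + ((⌈K / ν⌉₊ : ℝ) / n) ^ e σ) + (min 1 ((M * W.period / ν) / (t - s))) ^ e σ))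
          * (‖w‖ * ‖ζ‖) := mul_le_mul_of_nonneg_right hmono hrest
      _ = _ := by ring
  · -- HIGH label: W7 at any phase with the constant `C₂h ≤ C₂h + C₁c`
    rw [not_le] at hco
    have h := hhigh ν hν n hn 𝔸 hodd hwin Tw hTw U hU s t hs0 hst htT hlong ℓ hℓ hco.le w hwcl ζ
    refine h.trans ?_
    have hmono := alw_mono hC₂h0 (show C₂h ≤ C₂h + C₁c by linarith) hXe0 hm0
    calc (C₂h * (C₂h * (ν ^ e σ + ((⌈K / ν⌉₊ : ℝ) / n) ^ e σ) + (min 1 ((M * W.period / ν) / (t - s))) ^ e σ)) * ‖w‖ * ‖ζ‖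
        = (C₂h * (C₂h * (ν ^ e σ + ((⌈K / ν⌉₊ : ℝ) / n) ^ e σ) + (min 1 ((M * W.period / ν) / (t - s))) ^ e σ)) * (‖w‖ * ‖ζ‖) := by ring
      _ ≤ ((C₂h + C₁c) * ((C₂h + C₁c) * (ν ^ e σ + ((⌈K / ν⌉₊ : ℝ) / n) ^ e σ) + (min 1 ((M * W.period / ν) / (t - s))) ^ e σ))
          * (‖w‖ * ‖ζ‖) := mul_le_mul_of_nonneg_right hmono hrest
      _ = _ := by ring

end Summit.AnomalousDissipation.AnomalousDissipation.Theorems.SolenoidalFractalHomogenisation.LagrangianStep.VmodFlat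

end
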